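import Summits.HodgeConjecture.HodgeConjecture.Theses.PadicSemiregularLift
import Summits.HodgeConjecture.HodgeConjecture.Theses.TropicalCuspLift
import Summits.HodgeConjecture.HodgeConjecture.Theses.HeckeOrbitCompactness
import Summits.HodgeConjecture.HodgeConjecture.Theses.DegreeSpectroscopy
import Summits.HodgeConjecture.HodgeConjecture.Theses.HeckePrymWeil
import Summits.HodgeConjecture.HodgeConjecture.Theses.NodalThetaWeil
import Summits.HodgeConjecture.HodgeConjecture.Theses.SupersingularIsotypicLift
import Summits.HodgeConjecture.HodgeConjecture.Theses.ConservativityLefschetz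
import Literature.AlgebraicGeometry.Motives.AbelianVarietyProjectiveChart
import Literature.Barriers.HodgeConjecture.ExceptionalHodgeClasses

/-!
# Negative lemmas for the crux `HodgeAbelianVarieties` (stmt-HodgeConjecture-1333): kill transfer

Cycle-2 output of the standing disprover (`refuter-cdisprove-stmt-HodgeConjecture-1333-g2-0`;
work file `Cruxes/HodgeAbelianVarieties/Disproof.lean`, §7–§8). No refutation of the crux exists
(it is the Hodge conjecture restricted to abelian varieties); this file records, sorry-free:

* the KILL-TRANSFER HUB: every typed abelian-variety instance of the Hodge conjecture elsewhere in
  the tree is a specialisation of the crux, so a refutation of any of them refutes the crux (stated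
  as contrapositives `¬ Item → ¬ HodgeAbelianVarieties`, the form a later refuter composes with a
  landed `¬ Item`): `HeckeOrbitCompactness.WeilClassesAlgebraic`, `DegreeSpectroscopy.WeilClassesAlgebraic`,
  `HeckePrymWeil.{HodgeWeilLadder, WeilSixfoldsSqrtMinus7, WeilTwelvefoldsSqrtMinus7,
  WeilTenfoldsSqrtMinus11, WeilDescending}`, `NodalThetaWeil.{WeilSixfolds, NodeDualClassesAlgebraic}`,
  `SupersingularIsotypicLift.CMAbelianHodge`, `TropicalCuspLift.WeilClassesAlgebraic` (the sixfold
  item `TropicalCuspLift.WeilSixfolds` is in `ExtremeCodimensions.lean`);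
* summit-equivalence of the crux modulo the complement items of three routes
  (`ConservativityLefschetz.AbelianComplement`, `HeckeOrbitCompactness.SummitOffWeilSector`,
  `HeckePrymWeil.SummitOffWeilSector`): with any of them, `¬ HodgeConjecture → ¬ crux`;
* the divisor-generated strengthening `Bᵖ = Dᵖ` of the crux is false, from the barrier facts
  `Weil1977_exceptionalHodgeClasses` / `Mumford1968_simpleFourfold_exceptionalHodgeClasses`
  (van Geemen LNM 1594, Thm. 4.11 / Thm. 4.5).
-/

noncomputable section

open CategoryTheory AlgebraicGeometry

namespace Summit.HodgeConjecture.HodgeConjecture.Theorems.HodgeAbelianVarieties.Negative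

open Summit.HodgeConjecture.HodgeConjecture.Theses.PadicSemiregularLift
open Literature.AlgebraicGeometry Literature.AlgebraicGeometry.HodgeTheory
  Literature.AlgebraicGeometry.Motives Literature.AlgebraicTopology.SingularHomology

/-- Specialisation of the crux at a prescribed dimension `A.dim = m` and codimension `p` (the
rewriting step shared by all transfers). [folklore] -/
theorem mem_algebraicClasses_of_dim_eq (h : HodgeAbelianVarieties) (A : AbelianVariety ℂ) {m : ℕ}
    (hA : A.dim = m) (p : ℕ) (c : singularCohomology ℂ ℂ (ComplexPoints A.X) (2 * p))
    (hc : IsRationalClass c) (hH : IsOfHodgeType m A.X (2 * p) p p c) :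
    c ∈ algebraicClasses A.X p := by
  have h2 := (h A).2 p c
  rw [hA] at h2
  exact h2 hc hH

/-- A non-algebraic Weil class in the sense of `HeckeOrbitCompactness.WeilClassesAlgebraic`
(Weil-type `2n`-folds, `n ≥ 2`, `φ² = -d`) kills the crux. [cite: Weil1977HodgeRing] -/
theorem not_of_not_heckeOrbitCompactness_weilClassesAlgebraic
    (hn : ¬ Summit.HodgeConjecture.HodgeConjecture.Theses.HeckeOrbitCompactness.WeilClassesAlgebraic) :
    ¬ HodgeAbelianVarieties :=
  fun h ↦ hn fun n _ _ _ A _ hA _ _ c hc hH _ ↦ mem_algebraicClasses_of_dim_eq h A hA n c hc hH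

/-- A non-algebraic Weil class in the sense of `DegreeSpectroscopy.WeilClassesAlgebraic`
(`f² - a f + b = 0`, eigenspace form) kills the crux. [cite: Weil1977HodgeRing] -/
theorem not_of_not_degreeSpectroscopy_weilClassesAlgebraic
    (hn : ¬ Summit.HodgeConjecture.HodgeConjecture.Theses.DegreeSpectroscopy.WeilClassesAlgebraic) :
    ¬ HodgeAbelianVarieties :=
  fun h ↦ hn fun A n _ _ _ hA _ _ _ _ c hc hH _ ↦ mem_algebraicClasses_of_dim_eq h A hA n c hc hH

/-- A non-algebraic Weil class in the sense of `TropicalCuspLift.WeilClassesAlgebraic` (Weil plane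
`E₊ ⊔ E₋`, all `n ≥ 2`) kills the crux. [cite: Weil1977HodgeRing] -/
theorem not_of_not_tropicalCuspLift_weilClassesAlgebraic
    (hn : ¬ Summit.HodgeConjecture.HodgeConjecture.Theses.TropicalCuspLift.WeilClassesAlgebraic) :
    ¬ HodgeAbelianVarieties :=
  fun h ↦ hn fun n _ _ _ A _ hA _ _ c hc hH _ ↦ mem_algebraicClasses_of_dim_eq h A hA n c hc hH

/-- A counterexample to `HeckePrymWeil.HodgeWeilLadder` (`K = ℚ(√-p)`, `p ≡ 3 (4)`, `p ≥ 7`)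
kills the crux. [cite: Weil1977HodgeRing] -/
theorem not_of_not_heckePrymWeil_hodgeWeilLadder
    (hn : ¬ Summit.HodgeConjecture.HodgeConjecture.Theses.HeckePrymWeil.HodgeWeilLadder) :
    ¬ HodgeAbelianVarieties :=
  fun h ↦ hn fun _ _ _ _ _ _ n _ A _ hA _ c hc hH _ ↦ mem_algebraicClasses_of_dim_eq h A hA n c hc hH

/-- A non-algebraic Weil class on a sixfold with `φ² = -7` (`HeckePrymWeil.WeilSixfoldsSqrtMinus7`)
kills the crux. [cite: Weil1977HodgeRing] -/
theorem not_of_not_heckePrymWeil_weilSixfoldsSqrtMinus7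
    (hn : ¬ Summit.HodgeConjecture.HodgeConjecture.Theses.HeckePrymWeil.WeilSixfoldsSqrtMinus7) :
    ¬ HodgeAbelianVarieties :=
  fun h ↦ hn fun A _ hA _ c hc hH _ ↦ mem_algebraicClasses_of_dim_eq h A hA 3 c hc hH

/-- Same for `HeckePrymWeil.WeilTwelvefoldsSqrtMinus7`. [cite: Weil1977HodgeRing] -/
theorem not_of_not_heckePrymWeil_weilTwelvefoldsSqrtMinus7
    (hn : ¬ Summit.HodgeConjecture.HodgeConjecture.Theses.HeckePrymWeil.WeilTwelvefoldsSqrtMinus7) :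
    ¬ HodgeAbelianVarieties :=
  fun h ↦ hn fun A _ hA _ c hc hH _ ↦ mem_algebraicClasses_of_dim_eq h A hA 6 c hc hH

/-- Same for `HeckePrymWeil.WeilTenfoldsSqrtMinus11`. [cite: Weil1977HodgeRing] -/
theorem not_of_not_heckePrymWeil_weilTenfoldsSqrtMinus11
    (hn : ¬ Summit.HodgeConjecture.HodgeConjecture.Theses.HeckePrymWeil.WeilTenfoldsSqrtMinus11) :
    ¬ HodgeAbelianVarieties :=
  fun h ↦ hn fun A _ hA _ c hc hH _ ↦ mem_algebraicClasses_of_dim_eq h A hA 5 c hc hH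

/-- Same for `HeckePrymWeil.WeilDescending` (its conclusion is an instance of the crux, whatever the
descent hypothesis). [cite: Weil1977HodgeRing] -/
theorem not_of_not_heckePrymWeil_weilDescending
    (hn : ¬ Summit.HodgeConjecture.HodgeConjecture.Theses.HeckePrymWeil.WeilDescending) :
    ¬ HodgeAbelianVarieties :=
  fun h ↦ hn fun _ _ _ _ n _ _ A _ hA _ c hc hH _ ↦ mem_algebraicClasses_of_dim_eq h A hA n c hc hH

/-- A non-algebraic Weil class on a Weil-type sixfold (`NodalThetaWeil.WeilSixfolds`, every `d`)
kills the crux. [cite: Weil1977HodgeRing] -/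
theorem not_of_not_nodalThetaWeil_weilSixfolds
    (hn : ¬ Summit.HodgeConjecture.HodgeConjecture.Theses.NodalThetaWeil.WeilSixfolds) :
    ¬ HodgeAbelianVarieties :=
  fun h ↦ hn fun _ _ A _ hA _ _ c hc hH _ ↦ mem_algebraicClasses_of_dim_eq h A hA 3 c hc hH

/-- Same for the weakening `NodalThetaWeil.NodeDualClassesAlgebraic` (Weil classes supported on a
divisor). [cite: Weil1977HodgeRing] -/
theorem not_of_not_nodalThetaWeil_nodeDualClassesAlgebraic
    (hn : ¬ Summit.HodgeConjecture.HodgeConjecture.Theses.NodalThetaWeil.NodeDualClassesAlgebraic) :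
    ¬ HodgeAbelianVarieties :=
  fun h ↦ hn fun _ _ A _ hA _ _ c hc hH _ _ ↦ mem_algebraicClasses_of_dim_eq h A hA 3 c hc hH

/-- A counterexample to HC on a CM abelian variety (`SupersingularIsotypicLift.CMAbelianHodge`)
kills the crux. [cite: Deligne1982HodgeCycles] -/
theorem not_of_not_supersingularIsotypicLift_cmAbelianHodge
    (hn : ¬ Summit.HodgeConjecture.HodgeConjecture.Theses.SupersingularIsotypicLift.CMAbelianHodge) :
    ¬ HodgeAbelianVarieties :=
  fun h ↦ hn fun A _ _ ↦ h A

/-- **Summit-equivalence modulo the complement item of route ConservativityLefschetz**: granting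
`AbelianComplement` (HC for abelian varieties ⇒ HC), a counterexample to the Hodge conjecture
ANYWHERE refutes the crux. [folklore] -/
theorem not_of_not_hodgeConjecture_of_abelianComplement
    (hcomp : Summit.HodgeConjecture.HodgeConjecture.Theses.ConservativityLefschetz.AbelianComplement)
    (hn : ¬ _root_.HodgeConjecture) : ¬ HodgeAbelianVarieties :=
  fun h ↦ hn (hcomp fun A _ ↦ h A)

/-- Same modulo `HeckeOrbitCompactness.SummitOffWeilSector`. [folklore] -/
theorem not_of_not_hodgeConjecture_of_heckeOrbitCompactness_summitOffWeilSector
    (hoff : Summit.HodgeConjecture.HodgeConjecture.Theses.HeckeOrbitCompactness.SummitOffWeilSector)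
    (hn : ¬ _root_.HodgeConjecture) : ¬ HodgeAbelianVarieties :=
  fun h ↦ hn (hoff fun n _ _ _ A _ hA _ _ c hc hH _ ↦ mem_algebraicClasses_of_dim_eq h A hA n c hc hH)

/-- Same modulo `HeckePrymWeil.SummitOffWeilSector`. [folklore] -/
theorem not_of_not_hodgeConjecture_of_heckePrymWeil_summitOffWeilSector
    (hoff : Summit.HodgeConjecture.HodgeConjecture.Theses.HeckePrymWeil.SummitOffWeilSector)
    (hn : ¬ _root_.HodgeConjecture) : ¬ HodgeAbelianVarieties :=
  fun h ↦ hn (hoff fun _ _ _ _ n _ A _ hA _ c hc hH _ ↦ mem_algebraicClasses_of_dim_eq h A hA n c hc hH)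

/-! ### The divisor-generated strengthening `Bᵖ = Dᵖ` is false (Weil 1977; Mumford 1968) -/

/-- **`Bᵖ = Dᵖ` fails on abelian varieties** (van Geemen LNM 1594 Thm. 4.11, from the barrier fact
`Weil1977_exceptionalHodgeClasses`): it is NOT the case that every rational `(p,p)`-class on a
complex abelian variety lies in the span of `p`-fold cup products of rational `(1,1)`-classes —
already for `dim A = 4`, `p = 2`. [cite: vanGeemen1994HodgeAV, Thm. 4.11] [cite: Weil1977HodgeRing] -/
theorem not_divisorGenerated_of_weil1977
    (hW : Literature.Barriers.HodgeConjecture.Weil1977_exceptionalHodgeClasses) :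
    ¬ ∀ (A : AbelianVariety ℂ) (p : ℕ) (c : singularCohomology ℂ ℂ (ComplexPoints A.X) (2 * p)),
        IsRationalClass c → IsOfHodgeType A.dim A.X (2 * p) p p c →
          c ∈ Literature.Barriers.HodgeConjecture.divisorClassesSpan A.X A.dim p := by
  intro hD
  obtain ⟨A, hdim, -, c, hc, hH, hnot⟩ := hW 2 le_rfl
  refine hnot ?_
  have h := hD A 2 c hc
  rw [hdim] at h
  exact h hH

/-- The same failure on a SIMPLE abelian fourfold (van Geemen Thm. 4.5, Mumford–Pohlmann; barrier
fact `Mumford1968_simpleFourfold_exceptionalHodgeClasses`). [cite: vanGeemen1994HodgeAV, Thm. 4.5] -/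
theorem not_divisorGenerated_simple_of_mumford1968
    (hM : Literature.Barriers.HodgeConjecture.Mumford1968_simpleFourfold_exceptionalHodgeClasses) :
    ¬ ∀ (A : AbelianVariety ℂ), A.IsSimple → ∀ (p : ℕ)
        (c : singularCohomology ℂ ℂ (ComplexPoints A.X) (2 * p)),
        IsRationalClass c → IsOfHodgeType A.dim A.X (2 * p) p p c →
          c ∈ Literature.Barriers.HodgeConjecture.divisorClassesSpan A.X A.dim p := by
  intro hD
  obtain ⟨A, hs, hdim, -, c, hc, hH, hnot⟩ := hM
  refine hnot ?_
  have h := hD A hs 2 c hc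
  rw [hdim] at h
  exact h hH

end Summit.HodgeConjecture.HodgeConjecture.Theorems.HodgeAbelianVarieties.Negative

end
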